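import Literature.Geometry.Kaehler.ComplexTorusAlbertTypeILefschetzGroupSymplecticFactors
import Literature.Geometry.Kaehler.ComplexTorusAlbertTypeIILefschetzGroupSymplecticFactors
import Literature.Geometry.Kaehler.ComplexTorusAlbertTypeIIILefschetzGroupOrthogonalFactors
import Literature.Geometry.Kaehler.ComplexTorusAlbertTypeIVLefschetzGroupLinearFactors
import Literature.Geometry.Kaehler.ComplexTorusAlbertClassificationLowDimension
import HarnessLib

/-!
# Milne's Summary table assembled, the «Group» column: for every simple polarised complex torus of dimension
# `g ≤ 7`, `S(X)(ℂ)` is a finite product of complex symplectic, orthogonal or general linear groups —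
# `∏_σ Sp_{2n}(ℂ)` (type I), `∏_w Sp_{2n_w}(ℂ)` (type II), `∏_w O_{m_w}(ℂ)` (type III), `∏_w GL_{m_w}(ℂ)` (type IV)

Layer `Literature/Geometry/Kaehler`, namespace `Literature.Geometry.Kaehler.ComplexTorus`; lane `lit-hodgefound`
(Track 2 foundations library), Layer A4 (Lefschetz groups), prover seat `lit-hodgefound-p17` (generation 62),
self-proposed rows g62-#5 and g62-#9 (the «`f` copies» form) — the assembly of the «Group» column in the style of skel-4's A4-94 (d)
`ComplexTorusLefschetzGroupConnectedAlbertTypes` (the «Connected» column), BY NAME on g61-#2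
`ComplexTorusAlbertTypeILefschetzGroupSymplecticFactors` (`IsSimple.nonempty_lefschetzGroupC_mulEquiv_pi_symplecticGroupC_of_isAlbertTypeI`),
g62-#2 `ComplexTorusAlbertTypeIILefschetzGroupSymplecticFactors`
(`IsSimple.nonempty_lefschetzGroupC_mulEquiv_pi_symplecticGroupC_of_isAlbertTypeII`), g62-#4
`ComplexTorusAlbertTypeIIILefschetzGroupOrthogonalFactors`
(`IsSimple.nonempty_lefschetzGroupC_mulEquiv_pi_orthogonalGroup_of_isAlbertTypeIII`), g61-#8
`ComplexTorusAlbertTypeIVLefschetzGroupLinearFactors`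
(`IsSimple.nonempty_lefschetzGroupC_mulEquiv_pi_generalLinearGroup_of_isAlbertTypeIV`) and p12's
`ComplexTorusAlbertClassificationLowDimension` (Albert's theorem for `g ≤ 7`: `IsSimple.isAlbertType_of_finrank_le_seven`,
`IsSimple.isAlbertTypeI_or_isAlbertTypeIV_of_odd`).  THEOREMS ONLY (no definition, no instance, no notation, no named
fact; D-0026, net debt 0).

## Sources, verbatim

* J. S. Milne, *Lefschetz classes on abelian varieties*, Duke Math. J. **96** (1999) 639–675 (held
  `paper:doi-10-1215-s0012-7094-99-09620-5`), §2 Summary, p. 652 (p0014 L5–L37): «The following table summarizes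
  the properties of the reductive groups `S(A)`. Type ∣ Group ∣ Semisimple ∣ Connected ∣ Dimension ∣ Rank: I ∣
  `Sp_{2g/f}` ∣ Yes ∣ Yes […] II ∣ `Sp_{g/f}` ∣ Yes ∣ Yes […] III ∣ `O_{g/f}` ∣ Yes ∣ No […] IV ∣ `GL_{g/(df)}` ∣ No ∣
  Yes […] The group `S(A)_{/k^al}` is isomorphic to `f` copies of the group listed in the second column».
* H. Lange, *Abelian Varieties over the Complex Numbers* (2023), §2.6.1 Proposition (the table of the four types
  with its restrictions; «The results of the first … column of the table follow from Theorems 2.6.5 and 2.6.8»),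
  §7.2.4 Exercise (4) (`Lf(X)`).
* B. Moonen, Yu. Zarhin, *Hodge classes on abelian varieties of low dimension*, Math. Ann. **315** (1999), §2
  («a simple `X` of prime dimension cannot be of Type 3»; tree: `IsSimple.isAlbertTypeI_or_isAlbertTypeIV_of_odd`).

## What is proved (`X = E/Ψ(ℤ^κ)` SIMPLE, polarised by `η` with rational Gram matrix `G`, `K = Z(End⁰(X))`)

* **`IsSimple.lefschetzGroupC_classicalFactors_of_finrank_le_seven`** — `g ≤ 7`: EITHER type I and
  `S(X)(ℂ) ≃* ∏_{σ : K → ℂ} Sp_{2n}(ℂ)` (`n·[K:ℚ] = g`), OR type II and `S(X)(ℂ) ≃* ∏_{w : InfinitePlace K} Sp_{2n_w}(ℂ)`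
  (`Σ_w 4n_w = 2g`), OR type III and `S(X)(ℂ) ≃* ∏_{w < n} O_{m_w}(ℂ)` (`Σ_w 2m_w = 2g`), OR type IV and
  `S(X)(ℂ) ≃* ∏_{w : InfinitePlace K} GL_{m_w}(ℂ)` (`d·Σ_w 2m_w = 2g`).
* **`IsSimple.lefschetzGroupC_symplectic_or_linearFactors_of_odd`** — odd `g ≤ 7` (`g = 1, 3, 5, 7`): no orthogonal
  factors — `S(X)(ℂ) ≃* ∏_σ Sp_{2n}(ℂ)` (type I) or `S(X)(ℂ) ≃* ∏_w GL_{m_w}(ℂ)` (type IV, `d = 1`).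
* (g62-#9) the same WITH MILNE'S MULTIPLICITIES «`f` copies of the group listed» (uniform block sizes, from the centre
  dictionary `ComplexTorusMatrixUnitFamilyCentreEigenspaces` through the four `…_mulEquiv_fun_…` theorems):
  **`IsSimple.lefschetzGroupC_classicalPowers_of_finrank_le_seven`** — (I) `S(X)(ℂ) ≃* Sp_{2n}(ℂ)^{Hom(K,ℂ)}`,
  `n·[K:ℚ] = g`; (II) `S(X)(ℂ) ≃* Sp_{2n}(ℂ)^{InfinitePlace K}`, `4n·[K:ℚ] = 2g`; (III) `S(X)(ℂ) ≃* O_m(ℂ)^{[K:ℚ]}`,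
  `2m·[K:ℚ] = 2g`; (IV) `S(X)(ℂ) ≃* GL_m(ℂ)^{InfinitePlace K}`, `d·m·[K:ℚ] = 2g`; and
  **`IsSimple.lefschetzGroupC_symplectic_or_linearPowers_of_odd`** (odd `g ≤ 7`).

NOT here: `g ≥ 8` (Albert's theorem for every `g` is `-- TODO(general form)` in p12's file; given the type, the four
implications hold in every dimension and are the cited per-type theorems).
-/

open Module Matrix NumberField
open Literature.RingTheory.CentralSimple (IsAlbertTypeI IsAlbertTypeII IsAlbertTypeIII IsAlbertTypeIV)

namespace Literature.Geometry.Kaehler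

namespace ComplexTorus

section Simple

variable {κ : Type} [Fintype κ] [DecidableEq κ] [Nonempty κ] {E : Type} [NormedAddCommGroup E] [NormedSpace ℂ E]
  [FiniteDimensional ℂ E] {Ψ : (κ → ℝ) ≃L[ℝ] E} {η : E [⋀^Fin 2]→L[ℝ] ℝ} {G : Matrix κ κ ℚ}

/-- **MILNE'S SUMMARY TABLE, THE «GROUP» COLUMN, FOR EVERY SIMPLE POLARISED COMPLEX TORUS OF DIMENSION `g ≤ 7`**:
with `K = Z(End⁰(X))` and `′` the Rosati involution, exactly as Albert's theorem sorts `(End⁰(X), ′)` —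
(I) `S(X)(ℂ) ≃* ∏_{σ : K → ℂ} Sp_{2n}(ℂ)`, `n·[K:ℚ] = g`; (II) `S(X)(ℂ) ≃* ∏_{w : InfinitePlace K} Sp_{2n_w}(ℂ)`,
`Σ_w 4 n_w = 2g`; (III) `S(X)(ℂ) ≃* ∏_{w < n} O_{m_w}(ℂ)`, `n ≥ 1`, `Σ_w 2 m_w = 2g`; (IV)
`S(X)(ℂ) ≃* ∏_{w : InfinitePlace K} GL_{m_w}(ℂ)`, `d · Σ_w 2 m_w = 2g`, `d = √[End⁰(X):K]` («Type ∣ Group: I ∣ Sp,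
II ∣ Sp, III ∣ O, IV ∣ GL … `S(A)_{/k^al}` is isomorphic to `f` copies of the group listed»; here `2g = #κ`).
[cite: Milne1999LefschetzClasses, §2 Summary table (p. 652)] [cite: Lange2023AbelianVarietiesComplex, §2.6.1 Proposition and §7.2.4 Exercise (4)] -/
theorem IsSimple.lefschetzGroupC_classicalFactors_of_finrank_le_seven (hX : IsSimple Ψ) (hη : IsRiemannForm Ψ η)
    (hG : G.map (Rat.cast : ℚ → ℝ) = latticeGram Ψ η) (hg : finrank ℂ E ≤ 7) :
    (IsAlbertTypeI (centerField Ψ hX) (endAlgRat Ψ) (rosatiEnd Ψ hη.1 hη.2.2 hG) ∧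
      ∃ n : ℕ, n * finrank ℚ (centerField Ψ hX) = finrank ℂ E ∧
        Nonempty (lefschetzGroupC Ψ G ≃* ((centerField Ψ hX →+* ℂ) → symplecticGroupC (Fin n)))) ∨
    (IsAlbertTypeII (centerField Ψ hX) (endAlgRat Ψ) (rosatiEnd Ψ hη.1 hη.2.2 hG) ∧
      ∃ n : InfinitePlace (centerField Ψ hX) → ℕ, ∑ w, 4 * n w = Fintype.card κ ∧
        Nonempty (lefschetzGroupC Ψ G ≃* ((w : InfinitePlace (centerField Ψ hX)) → symplecticGroupC (Fin (n w))))) ∨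
    (IsAlbertTypeIII (centerField Ψ hX) (endAlgRat Ψ) (rosatiEnd Ψ hη.1 hη.2.2 hG) ∧
      ∃ (n : ℕ) (m : Fin n → ℕ), 0 < n ∧ ∑ w, 2 * m w = Fintype.card κ ∧
        Nonempty (lefschetzGroupC Ψ G ≃* ((w : Fin n) → Matrix.orthogonalGroup (Fin (m w)) ℂ))) ∨
    (IsAlbertTypeIV (centerField Ψ hX) (endAlgRat Ψ) (rosatiEnd Ψ hη.1 hη.2.2 hG) ∧
      ∃ m : InfinitePlace (centerField Ψ hX) → ℕ,
        Nat.sqrt (finrank (centerField Ψ hX) (endAlgRat Ψ)) * ∑ w, 2 * m w = Fintype.card κ ∧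
        Nonempty (lefschetzGroupC Ψ G ≃* ((w : InfinitePlace (centerField Ψ hX)) → GL (Fin (m w)) ℂ))) := by
  rcases hX.isAlbertType_of_finrank_le_seven hη hG hg with h | h | h | h
  · refine Or.inl ⟨h, ?_⟩
    obtain ⟨n, hn, -, hiso⟩ := hX.nonempty_lefschetzGroupC_mulEquiv_pi_symplecticGroupC_of_isAlbertTypeI hη hG h
    exact ⟨n, hn, hiso⟩
  · exact Or.inr (Or.inl ⟨h, hX.nonempty_lefschetzGroupC_mulEquiv_pi_symplecticGroupC_of_isAlbertTypeII hη hG h⟩)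
  · exact Or.inr (Or.inr (Or.inl ⟨h, hX.nonempty_lefschetzGroupC_mulEquiv_pi_orthogonalGroup_of_isAlbertTypeIII hη hG h⟩))
  · exact Or.inr (Or.inr (Or.inr ⟨h, hX.nonempty_lefschetzGroupC_mulEquiv_pi_generalLinearGroup_of_isAlbertTypeIV hη hG h⟩))

/-- **ODD DIMENSION `g ≤ 7` (`g = 1, 3, 5, 7`): NO ORTHOGONAL FACTORS** — a simple polarised complex torus of odd
dimension `≤ 7` is of type I or of type IV with `d = 1` («a simple `X` of prime dimension cannot be of Type 3»; types
II, III need `2 ∣ g/f`), so `S(X)(ℂ) ≃* ∏_{σ : K → ℂ} Sp_{2n}(ℂ)` (`n·[K:ℚ] = g`) or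
`S(X)(ℂ) ≃* ∏_{w : InfinitePlace K} GL_{m_w}(ℂ)` (`Σ_w 2 m_w = 2g`); in particular `S(X)(ℂ)` is connected (the tree's
`IsSimple.lefschetzIdentityC_eq_lefschetzGroupC_of_odd`). [cite: Milne1999LefschetzClasses, §2 Summary table (p. 652)]
[cite: MoonenZarhin1999LowDim, §2 («a simple `X` of prime dimension cannot be of Type 3»)]
[cite: Lange2023AbelianVarietiesComplex, §2.6.1 Proposition («restriction» column)] -/
theorem IsSimple.lefschetzGroupC_symplectic_or_linearFactors_of_odd (hX : IsSimple Ψ) (hη : IsRiemannForm Ψ η)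
    (hG : G.map (Rat.cast : ℚ → ℝ) = latticeGram Ψ η) (hg : finrank ℂ E ≤ 7) (hodd : Odd (finrank ℂ E)) :
    (IsAlbertTypeI (centerField Ψ hX) (endAlgRat Ψ) (rosatiEnd Ψ hη.1 hη.2.2 hG) ∧
      ∃ n : ℕ, n * finrank ℚ (centerField Ψ hX) = finrank ℂ E ∧
        Nonempty (lefschetzGroupC Ψ G ≃* ((centerField Ψ hX →+* ℂ) → symplecticGroupC (Fin n)))) ∨
    (IsAlbertTypeIV (centerField Ψ hX) (endAlgRat Ψ) (rosatiEnd Ψ hη.1 hη.2.2 hG) ∧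
      finrank (centerField Ψ hX) (endAlgRat Ψ) = 1 ∧
      ∃ m : InfinitePlace (centerField Ψ hX) → ℕ, ∑ w, 2 * m w = Fintype.card κ ∧
        Nonempty (lefschetzGroupC Ψ G ≃* ((w : InfinitePlace (centerField Ψ hX)) → GL (Fin (m w)) ℂ))) := by
  obtain ⟨h | h, h1⟩ := hX.isAlbertTypeI_or_isAlbertTypeIV_of_odd hη hG hg hodd
  · refine Or.inl ⟨h, ?_⟩
    obtain ⟨n, hn, -, hiso⟩ := hX.nonempty_lefschetzGroupC_mulEquiv_pi_symplecticGroupC_of_isAlbertTypeI hη hG h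
    exact ⟨n, hn, hiso⟩
  · refine Or.inr ⟨h, h1, ?_⟩
    obtain ⟨m, hm, hiso⟩ := hX.nonempty_lefschetzGroupC_mulEquiv_pi_generalLinearGroup_of_isAlbertTypeIV hη hG h
    refine ⟨m, ?_, hiso⟩
    rw [h1, Nat.sqrt_one, one_mul] at hm
    exact hm

/-- **MILNE'S SUMMARY TABLE WITH ITS MULTIPLICITIES, `g ≤ 7`: «`S(A)_{/k^al}` IS ISOMORPHIC TO `f` COPIES OF THE GROUP
LISTED»** — for every simple polarised complex torus of dimension `g ≤ 7`, with `K = Z(End⁰(X))`: (I) `S(X)(ℂ) ≃*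
Sp_{2n}(ℂ)^{Hom(K,ℂ)}`, `n · [K:ℚ] = g` («I ∣ Sp_{2g/f}», `f = [K:ℚ]`); (II) `S(X)(ℂ) ≃* Sp_{2n}(ℂ)^{InfinitePlace K}`,
`4n · [K:ℚ] = 2g` («II ∣ Sp_{g/f}», `f = [K:ℚ] = #InfinitePlace K`); (III) `S(X)(ℂ) ≃* O_m(ℂ)^{Fin [K:ℚ]}`,
`2m · [K:ℚ] = 2g` («III ∣ O_{g/f}»); (IV) `S(X)(ℂ) ≃* GL_m(ℂ)^{InfinitePlace K}`, `d · m · [K:ℚ] = 2g`,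
`d = √[End⁰(X):K]` («IV ∣ GL_{g/(df)}», `f = #InfinitePlace K`, `[K:ℚ] = 2f` for the CM centre); `2g = #κ`.
[cite: Milne1999LefschetzClasses, §2 Summary table (p. 652: «Type ∣ Group: I ∣ Sp_{2g/f}, II ∣ Sp_{g/f}, III ∣ O_{g/f}, IV ∣ GL_{g/(df)}», «`f` copies of the group listed in the second column»)]
[cite: Lange2023AbelianVarietiesComplex, §2.6.1 Proposition and §7.2.4 Exercise (4)] -/
theorem IsSimple.lefschetzGroupC_classicalPowers_of_finrank_le_seven (hX : IsSimple Ψ) (hη : IsRiemannForm Ψ η)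
    (hG : G.map (Rat.cast : ℚ → ℝ) = latticeGram Ψ η) (hg : finrank ℂ E ≤ 7) :
    (IsAlbertTypeI (centerField Ψ hX) (endAlgRat Ψ) (rosatiEnd Ψ hη.1 hη.2.2 hG) ∧
      ∃ n : ℕ, n * finrank ℚ (centerField Ψ hX) = finrank ℂ E ∧
        Nonempty (lefschetzGroupC Ψ G ≃* ((centerField Ψ hX →+* ℂ) → symplecticGroupC (Fin n)))) ∨
    (IsAlbertTypeII (centerField Ψ hX) (endAlgRat Ψ) (rosatiEnd Ψ hη.1 hη.2.2 hG) ∧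
      ∃ n : ℕ, 4 * n * finrank ℚ (centerField Ψ hX) = Fintype.card κ ∧
        Nonempty (lefschetzGroupC Ψ G ≃* (InfinitePlace (centerField Ψ hX) → symplecticGroupC (Fin n)))) ∨
    (IsAlbertTypeIII (centerField Ψ hX) (endAlgRat Ψ) (rosatiEnd Ψ hη.1 hη.2.2 hG) ∧
      ∃ m : ℕ, 2 * m * finrank ℚ (centerField Ψ hX) = Fintype.card κ ∧
        Nonempty (lefschetzGroupC Ψ G ≃*
          (Fin (finrank ℚ (centerField Ψ hX)) → Matrix.orthogonalGroup (Fin m) ℂ))) ∨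
    (IsAlbertTypeIV (centerField Ψ hX) (endAlgRat Ψ) (rosatiEnd Ψ hη.1 hη.2.2 hG) ∧
      ∃ m : ℕ, Nat.sqrt (finrank (centerField Ψ hX) (endAlgRat Ψ)) * m * finrank ℚ (centerField Ψ hX) =
          Fintype.card κ ∧
        Nonempty (lefschetzGroupC Ψ G ≃* (InfinitePlace (centerField Ψ hX) → GL (Fin m) ℂ))) := by
  rcases hX.isAlbertType_of_finrank_le_seven hη hG hg with h | h | h | h
  · refine Or.inl ⟨h, ?_⟩
    obtain ⟨n, hn, -, hiso⟩ := hX.nonempty_lefschetzGroupC_mulEquiv_pi_symplecticGroupC_of_isAlbertTypeI hη hG h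
    exact ⟨n, hn, hiso⟩
  · exact Or.inr (Or.inl ⟨h, hX.nonempty_lefschetzGroupC_mulEquiv_fun_symplecticGroupC_of_isAlbertTypeII hη hG h⟩)
  · exact Or.inr (Or.inr (Or.inl ⟨h, hX.nonempty_lefschetzGroupC_mulEquiv_fun_orthogonalGroup_of_isAlbertTypeIII hη hG h⟩))
  · exact Or.inr (Or.inr (Or.inr ⟨h, hX.nonempty_lefschetzGroupC_mulEquiv_fun_generalLinearGroup_of_isAlbertTypeIV hη hG h⟩))

/-- **ODD DIMENSION `g ≤ 7` WITH MULTIPLICITIES**: `S(X)(ℂ) ≃* Sp_{2n}(ℂ)^{Hom(K,ℂ)}` (`n · [K:ℚ] = g`, type I) or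
`S(X)(ℂ) ≃* GL_m(ℂ)^{InfinitePlace K}` (`m · [K:ℚ] = 2g`, type IV with `d = 1`: «`f` copies of `GL_{g/f}`»).
[cite: Milne1999LefschetzClasses, §2 Summary table (p. 652)]
[cite: MoonenZarhin1999LowDim, §2 («a simple `X` of prime dimension cannot be of Type 3»)]
[cite: Lange2023AbelianVarietiesComplex, §2.6.1 Proposition («restriction» column)] -/
theorem IsSimple.lefschetzGroupC_symplectic_or_linearPowers_of_odd (hX : IsSimple Ψ) (hη : IsRiemannForm Ψ η)
    (hG : G.map (Rat.cast : ℚ → ℝ) = latticeGram Ψ η) (hg : finrank ℂ E ≤ 7) (hodd : Odd (finrank ℂ E)) :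
    (IsAlbertTypeI (centerField Ψ hX) (endAlgRat Ψ) (rosatiEnd Ψ hη.1 hη.2.2 hG) ∧
      ∃ n : ℕ, n * finrank ℚ (centerField Ψ hX) = finrank ℂ E ∧
        Nonempty (lefschetzGroupC Ψ G ≃* ((centerField Ψ hX →+* ℂ) → symplecticGroupC (Fin n)))) ∨
    (IsAlbertTypeIV (centerField Ψ hX) (endAlgRat Ψ) (rosatiEnd Ψ hη.1 hη.2.2 hG) ∧
      finrank (centerField Ψ hX) (endAlgRat Ψ) = 1 ∧
      ∃ m : ℕ, m * finrank ℚ (centerField Ψ hX) = Fintype.card κ ∧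
        Nonempty (lefschetzGroupC Ψ G ≃* (InfinitePlace (centerField Ψ hX) → GL (Fin m) ℂ))) := by
  obtain ⟨h | h, h1⟩ := hX.isAlbertTypeI_or_isAlbertTypeIV_of_odd hη hG hg hodd
  · refine Or.inl ⟨h, ?_⟩
    obtain ⟨n, hn, -, hiso⟩ := hX.nonempty_lefschetzGroupC_mulEquiv_pi_symplecticGroupC_of_isAlbertTypeI hη hG h
    exact ⟨n, hn, hiso⟩
  · refine Or.inr ⟨h, h1, ?_⟩
    obtain ⟨m, hm, hiso⟩ := hX.nonempty_lefschetzGroupC_mulEquiv_fun_generalLinearGroup_of_isAlbertTypeIV hη hG h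
    refine ⟨m, ?_, hiso⟩
    rw [h1, Nat.sqrt_one, one_mul] at hm
    exact hm

end Simple

end ComplexTorus

end Literature.Geometry.Kaehler
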